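import Summits.RiemannHypothesis.RiemannHypothesis.Theorems.Splittings.BombieriTruncOrdinateCount
import HarnessLib

/-!
# Splittings — x-wuc GEN-8 (xiv-f) 5/5: the numeric instance `δ = 2` above `T₀ = e^{256}` and the endpoint criterion `Φ(½) ≤ 0.701`
# — the ★ row `RH ↔ RH(e^{256}) ∧ B′₁([−1,1])` modulo `MassAwareSampling 2 θ` (`θ ≥ 0.056`)

Cell rh-split, seat rh-split-x-wuc g8 (brief sha16 f79c5f09d8bcb036), card `run/shared/lean/pub/rh-split/cards/SPLIT-x-wuc.md` §14.
CARVE NOTE (lane (xiv-f), lead RULING #113): part 5/5 of the VERBATIM carve of §G8.4–§G8.12 of the FROZEN scratch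
`HOME/rh-split-x-wuc/SplitXWucG8.lean` sha16 72896d9b60505e56 (rider 5 FINAL, x-wuc g8 DONE; ref g6 REPLAY PASS 13:08:54Z),
source lines l.1408–1540, by rh-split-typer-3 g0; §G8.1–§G8.3 are the landed `Splittings/BombieriTruncMassAware.lean` (p531810), whose
namespace `…Splittings.BombieriTruncMassAware` every part RE-OPENS (FQNs do not move); the scratch's `#print axioms` guards are not
carried (referee `--axioms` replay instead); untagged parameterised `def … : Prop` hypotheses (`LocBand`, `HelperBand`, `OrdinateBand`)
are kept VERBATIM (typer's discretion per HANDOFF-g8: predicates / discharged hypotheses, not Literature facts).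

* G8.11 `hswArith_two_exp256` (δ = 2 above `e^{256}`: `log(1+x) ≤ x`, `log L′ ≤ 6 log 2 + L′/64 − 1`, `log 2π ≤ 2π − 1`, `π < 3.15`),
  `rh_iff_rhUpTo_exp256_and_boundedAwayAt`.
* G8.12 `sinh_div_mono` (convexity of `sinh` on `[0,∞)` + `ConvexOn.secant_mono`), `Phi_mono`, `crit_of_half`, `sinh_one_le`, `Phi_half_le`
  (`Φ(½) ≤ 0.701`) and the ★ row `rh_iff_rhUpTo_exp256_and_boundedAwayAt'`.
LABEL (referee g6 13:08:54Z): ★ = RH ⟺ FIN(e^256, uncertified/out of reach) ∧ B′₁ (CONDITIONAL-on Bombieri (c) at level one) MODULO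
`MassAwareSampling 2 θ` (cell-coined, NOT in print — bookkeeping) + the HSW print fact; tautology test passed; certifies nothing about RH.
HONEST LABEL: «SPLITTING SEARCH over kernel-typed RH-EQUIVALENCES; a splitting A ∧ B ⟹ RH is CONDITIONAL bookkeeping
unless A and B are both proved; nothing here bears on the truth of RH.»
-/

set_option linter.dupNamespace false

noncomputable section

open scoped Classical ComplexConjugate
open Set Filter Topology Complex MeasureTheory

namespace Summit.RiemannHypothesis.RiemannHypothesis.Theorems.Splittings.BombieriTruncMassAware

open Literature.NumberTheory.LFunctions Literature.NumberTheory.LFunctions.Bombieri2000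
open Summit.RiemannHypothesis.RiemannHypothesis.Theses.RuelleBand
open Summit.RiemannHypothesis.RiemannHypothesis.Theorems.Splittings.BombieriTruncEigen
open Summit.RiemannHypothesis.RiemannHypothesis.Theorems.Splittings.BombieriFozNoDep
open Summit.RiemannHypothesis.RiemannHypothesis.Theorems.Splittings.BombieriTruncGram
open Summit.RiemannHypothesis.RiemannHypothesis.Theorems.Splittings.BombieriTruncPairing
open Summit.RiemannHypothesis.RiemannHypothesis.Theorems.Splittings.BombieriTruncScreening
open Summit.RiemannHypothesis.RiemannHypothesis.Theorems.Splittings.BombieriTruncBandGap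
open Summit.RiemannHypothesis.RiemannHypothesis.Theorems.Splittings.BombieriTruncMultiplicity
open Summit.RiemannHypothesis.RiemannHypothesis.Theorems.Splittings.BombieriTruncEventualStrip
open Summit.RiemannHypothesis.RiemannHypothesis.Theorems.Splittings.BombieriTruncExactness
open Summit.RiemannHypothesis.RiemannHypothesis.Theorems.Splittings.BombieriTruncClump
open Summit.RiemannHypothesis.RiemannHypothesis.Theorems.Splittings.BombieriTruncOffLineSparse
open Summit.RiemannHypothesis.RiemannHypothesis.Theorems.Splittings.BombieriTruncSynthesis
open Summit.RiemannHypothesis.RiemannHypothesis.Theorems.Splittings.BombieriTruncSynthesisScreening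
open Summit.RiemannHypothesis.RiemannHypothesis.Theorems.Splittings.BombieriTruncSynthesisRows
open Literature.NumberTheory.DiophantineGeometry (RiemannHypothesisUpTo)

variable {N : ℕ}

/-! ### G8.11 (K-inst) A numeric instance of the δ-arithmetic: `δ = 2` above `T₀ = e^{256}`

With `L = log τ₀ ≥ 256`, `L' = log(τ₀(1 + 1/8π)) ≤ L + 1/24`, `log L' ≤ log 64 + L'/64 − 1`, `log 64 = 6 log 2 < 4.16`,
`log(2π) ≤ 2π − 1` and `π < 3.15`:  `2·q + 0.03 ≤ 0.2157·L + 20.4 ≤ 0.3174·L − 1.69 ≤ 2·D(τ₀)` as soon as `L ≥ 217`.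
So row X-7/HSW specialises to `RH ↔ RH(e^{256}) ∧ B′₁([−1,1])` modulo `MassAwareSampling 2 θ` (θ > 2·Φ(½)/8π ≈ 0.0558),
the criterion and the HSW print fact.  Conditional bookkeeping; nothing here bears on the truth of RH. -/

/-- K-inst: `δ = 2` satisfies the δ-arithmetic of `ordinateBand_of_hsw` above `T₀ = e^{256}`. -/
theorem hswArith_two_exp256 (τ₀ : ℝ) (hτ : Real.exp 256 < τ₀) :
    2 * FordFarZeros.hswErr (τ₀ + τ₀ / (8 * Real.pi)) + 3 / 100 ≤ 2 * zdens τ₀ := by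
  have hπ3 : (3 : ℝ) < Real.pi := Real.pi_gt_three
  have hπ315 : Real.pi < 3.15 := Real.pi_lt_d2
  have hπ0 : 0 < Real.pi := Real.pi_pos
  have hτ0 : 0 < τ₀ := (Real.exp_pos _).trans hτ
  have hL : (256 : ℝ) ≤ Real.log τ₀ := by
    rw [Real.le_log_iff_exp_le hτ0]; exact hτ.le
  -- the shifted evaluation point `τ₀ + τ₀/8π = τ₀ · (1 + 1/8π)`
  have hfac : 0 < 1 + 1 / (8 * Real.pi) := by positivity
  have ht' : τ₀ + τ₀ / (8 * Real.pi) = τ₀ * (1 + 1 / (8 * Real.pi)) := by ring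
  have hL'eq : Real.log (τ₀ + τ₀ / (8 * Real.pi)) = Real.log τ₀ + Real.log (1 + 1 / (8 * Real.pi)) := by
    rw [ht', Real.log_mul hτ0.ne' hfac.ne']
  have hlf0 : 0 ≤ Real.log (1 + 1 / (8 * Real.pi)) :=
    Real.log_nonneg (by linarith [show 0 < 1 / (8 * Real.pi) from by positivity])
  have hlf1 : Real.log (1 + 1 / (8 * Real.pi)) ≤ 1 / 24 := by
    have h1 := Real.log_le_sub_one_of_pos hfac
    have h2 : 1 / (8 * Real.pi) ≤ 1 / 24 :=
      one_div_le_one_div_of_le (by norm_num) (by linarith)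
    linarith
  set L := Real.log τ₀ with hLdef
  set L' := Real.log (τ₀ + τ₀ / (8 * Real.pi)) with hL'def
  have hL'1 : L ≤ L' := by linarith
  have hL'2 : L' ≤ L + 1 / 24 := by linarith
  have hL'pos : 0 < L' := by linarith
  -- `log L' ≤ 6 log 2 + L'/64 − 1`
  have hlogL' : Real.log L' ≤ 6 * Real.log 2 + (L' / 64 - 1) := by
    have h1 : Real.log L' = Real.log 64 + Real.log (L' / 64) := by
      rw [← Real.log_mul (by norm_num) (by positivity)]; congr 1; ring
    have h2 : Real.log (64 : ℝ) = 6 * Real.log 2 := by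
      rw [show (64 : ℝ) = 2 ^ 6 by norm_num, Real.log_pow]; norm_num
    have h3 : Real.log (L' / 64) ≤ L' / 64 - 1 := Real.log_le_sub_one_of_pos (by positivity)
    linarith
  have hlog2 : Real.log 2 < 0.6931471808 := Real.log_two_lt_d9
  have hlog2π : Real.log (2 * Real.pi) ≤ 2 * Real.pi - 1 := Real.log_le_sub_one_of_pos (by positivity)
  -- both sides in terms of `L`, `L'`
  have hz : zdens τ₀ = (L - Real.log (2 * Real.pi)) / (2 * Real.pi) := by
    unfold zdens; rw [Real.log_div hτ0.ne' (by positivity)]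
  have hq : FordFarZeros.hswErr (τ₀ + τ₀ / (8 * Real.pi)) = 0.1038 * L' + 0.2573 * Real.log L' + 9.3675 := by
    rw [hL'def]; rfl
  rw [hz, hq]
  set X := (L - Real.log (2 * Real.pi)) / (2 * Real.pi) with hXdef
  have hX : 2 * Real.pi * X = L - Real.log (2 * Real.pi) := by
    rw [hXdef]; field_simp
  have hXnn : 0 ≤ X := by
    rw [hXdef]; exact div_nonneg (by linarith) (by positivity)
  have hXpi : Real.pi * X ≤ 3.15 * X := mul_le_mul_of_nonneg_right hπ315.le hXnn
  linarith

/-- Row X-7/HSW at `T₀ = e^{256}`, `δ = 2`: `RH ⟺ RH(e^{256}) ∧ B′₁([−1,1])` modulo `MassAwareSampling 2 θ`, the criterion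
`2·Φ(κ₀) < 8πθ` on `(0, ½)` and the HSW print fact.  Conditional bookkeeping; nothing here bears on the truth of RH. -/
theorem rh_iff_rhUpTo_exp256_and_boundedAwayAt {θ : ℝ} (hθ : 0 < θ) (hS : MassAwareSampling 2 θ)
    (hcrit : ∀ κ₀ : ℝ, 0 < κ₀ → κ₀ < 1 / 2 → 2 * Phi κ₀ < 8 * Real.pi * θ)
    (hHSW : zetaZeroCount_hasanalizade_shen_wong) :
    _root_.RiemannHypothesis ↔
      RiemannHypothesisUpTo (Real.exp 256) ∧ TruncNegEigenvalueBoundedAwayAt (Icc (-1 : ℝ) 1) 1 :=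
  rh_iff_rhUpTo_and_boundedAwayAt_of_hsw hθ hS hcrit hHSW hswArith_two_exp256 (by
    have h1 : 2 * Real.pi ≤ Real.exp (2 * Real.pi) := by linarith [Real.add_one_le_exp (2 * Real.pi)]
    have h2 : Real.exp (2 * Real.pi) * Real.exp (2 * Real.pi) = Real.exp (4 * Real.pi) := by
      rw [← Real.exp_add]; ring_nf
    have h3 : Real.exp (4 * Real.pi) ≤ Real.exp 256 := Real.exp_le_exp.mpr (by linarith [Real.pi_lt_d2])
    have h4 : 2 * Real.pi * Real.exp (2 * Real.pi) ≤ Real.exp (2 * Real.pi) * Real.exp (2 * Real.pi) :=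
      mul_le_mul_of_nonneg_right h1 (Real.exp_pos _).le
    linarith)

/-! ### G8.12 (K-Φ) The criterion from its endpoint value: `Φ` is increasing, `Φ(½) ≤ 0.701`

`sinh` is convex on `[0, ∞)` (second derivative `sinh ≥ 0`), so the chord slope `sinh x / x` from `0` is increasing
(`ConvexOn.secant_mono`); hence `Φ(κ) = 4(sinh 2κ / 2κ − 1)` is increasing on `(0, ∞)` and the criterion
`∀ κ₀ ∈ (0, ½), δ·Φ(κ₀) < 8πθ` follows from its endpoint form `δ·Φ(½) < 8πθ`; with `sinh 1 ≤ 1.1752012`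
(`Real.exp_one_lt_d9/gt_d9`) this gives the clean large-height row below (`δ = 2`, any `θ ≥ 0.056`). -/

/-- `sinh x / x` is increasing on `(0, ∞)` (convexity of `sinh` on `[0, ∞)` and `ConvexOn.secant_mono`). -/
theorem sinh_div_mono {x y : ℝ} (hx : 0 < x) (hxy : x ≤ y) : Real.sinh x / x ≤ Real.sinh y / y := by
  have hconv : ConvexOn ℝ (Ici (0:ℝ)) Real.sinh := by
    refine convexOn_of_deriv2_nonneg (convex_Ici 0) Real.continuous_sinh.continuousOn
      Real.differentiable_sinh.differentiableOn ?_ ?_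
    · rw [Real.deriv_sinh]; exact Real.differentiable_cosh.differentiableOn
    · intro z hz
      rw [interior_Ici] at hz
      simp only [Function.iterate_succ_apply', Function.iterate_zero_apply, Real.deriv_sinh, Real.deriv_cosh]
      exact Real.sinh_nonneg_iff.mpr (le_of_lt hz)
  have := hconv.secant_mono (a := 0) (x := x) (y := y) (by simp) (by simpa using hx.le)
    (by simp only [mem_Ici]; linarith) hx.ne' (by linarith) hxy
  simpa [Real.sinh_zero] using this

/-- `Φ` is increasing on `(0, ∞)`. -/
theorem Phi_mono {κ₁ κ₂ : ℝ} (h1 : 0 < κ₁) (h12 : κ₁ ≤ κ₂) : Phi κ₁ ≤ Phi κ₂ := by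
  unfold Phi
  have := sinh_div_mono (by linarith : 0 < 2 * κ₁) (by linarith : 2 * κ₁ ≤ 2 * κ₂)
  linarith

/-- The criterion of T8c from its endpoint form. -/
theorem crit_of_half {δ θ : ℝ} (hδ : 0 ≤ δ) (h : δ * Phi (1 / 2) < 8 * Real.pi * θ) :
    ∀ κ₀ : ℝ, 0 < κ₀ → κ₀ < 1 / 2 → δ * Phi κ₀ < 8 * Real.pi * θ := fun _ h0 h1 ↦
  lt_of_le_of_lt (mul_le_mul_of_nonneg_left (Phi_mono h0 h1.le) hδ) h

/-- `sinh 1 ≤ 1.1752012` (from the tree's `e` enclosures). -/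
theorem sinh_one_le : Real.sinh 1 ≤ 1.1752012 := by
  rw [Real.sinh_eq]
  have he := Real.exp_one_lt_d9
  have he' := Real.exp_one_gt_d9
  have hinv : (2.7182818286 : ℝ)⁻¹ ≤ (Real.exp 1)⁻¹ := inv_anti₀ (Real.exp_pos 1) he.le
  rw [Real.exp_neg 1]
  have h3 : (0.36787944 : ℝ) ≤ (2.7182818286 : ℝ)⁻¹ := by norm_num
  linarith

/-- `Φ(½) = 4(sinh 1 − 1) ≤ 0.701` (numerically `0.70080…`). -/
theorem Phi_half_le : Phi (1 / 2) ≤ 0.701 := by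
  have h : Phi (1 / 2) = 4 * (Real.sinh 1 - 1) := by unfold Phi; norm_num
  rw [h]; linarith [sinh_one_le]

/-- Row X-7/e²⁵⁶, clean form: for ANY `θ ≥ 0.056`, `MassAwareSampling 2 θ` and the HSW print fact give
`RH ⟺ RH(e^{256}) ∧ B′₁([−1,1])`.  The whole ζ-side and all arithmetic are kernel-checked; the ONE open analytic input is the
ζ-free weighted least-squares inequality `MassAwareSampling 2 θ` (conjecture), the conjunct `B′₁` is Bombieri's question (c) at
level one.  Conditional bookkeeping; nothing here bears on the truth of RH. -/
theorem rh_iff_rhUpTo_exp256_and_boundedAwayAt' {θ : ℝ} (hθ : 0.056 ≤ θ) (hS : MassAwareSampling 2 θ)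
    (hHSW : zetaZeroCount_hasanalizade_shen_wong) :
    _root_.RiemannHypothesis ↔
      RiemannHypothesisUpTo (Real.exp 256) ∧ TruncNegEigenvalueBoundedAwayAt (Icc (-1 : ℝ) 1) 1 :=
  rh_iff_rhUpTo_exp256_and_boundedAwayAt (by linarith) hS
    (crit_of_half (by norm_num) (by
      have h1 := Phi_half_le
      have hπ := Real.pi_gt_d4
      have h2 : 8 * Real.pi * 0.056 ≤ 8 * Real.pi * θ := mul_le_mul_of_nonneg_left hθ (by positivity)
      linarith)) hHSW

end Summit.RiemannHypothesis.RiemannHypothesis.Theorems.Splittings.BombieriTruncMassAware
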